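import Mathlib
import HarnessLib
import Summits.NavierStokesRegularity.NavierStokesRegularity.Theorems.PoloidalWindowDoorLrcModEntireShearedSecondOrder

/-!
# Route `PoloidalWindowDoor`, item `LrcModEntire` (stmt-NavierStokesRegularity-20428), cell (Q4-sonic, straight branch), case I, PERIODIC branch —
# SHEARED CALCULUS FOR A GENERAL SPACE–TIME SCALAR (P2b-i of the LEAD picks; T2B-g17 v10 §9/§10)

Cell ns-regularity-ideate, LEAD-lineage seat ns-poloidal-K2-p3 g17 (`--supports stmt-NavierStokesRegularity-20428`).  Class-free.

ns-k2-port-2 g8's `…ShearedSecondOrder` proves, for the specific scalar `gST W e`, the identities needed to pull the class-level transport law back to the tube: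
time derivative, spatial second derivatives, and «`∂_m² + ∂_s²` = horizontal Laplacian».  Here the SAME identities for an ARBITRARY scalar `F : ℝ × ℝ³ → ℝ`
smooth on `T × ℝ³` (the periodic branch applies them to `F(t,y) = U₂(t, y + a) − U₂(t, y)`):
* `scalar_regular` — `F` is `C^∞`/differentiable/twice differentiable at points of `T × ℝ³`;
* `fderiv_scalar_time` — `DF(t,x)[(1,0)] = d/ds F(s,x)|ₛ₌ₜ`;
* `fderiv_fderiv_scalar_space` — `D²F(t,x)[(0,a)][(0,b)] = ∂_a∂_b F(t,·)(x)` (nested slice derivatives);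
* ★ `pd_sum_scalar_comp_shearMap` — at a tube point `p` with `Φp = (t,x)`, `e` a horizontal unit: `∂_m²(F∘Φ)(p) + ∂_s²(F∘Φ)(p) = ∂₀∂₀F(t,·)(x) + ∂₁∂₁F(t,·)(x)`.

WHAT THIS IS NOT: not a claim about Navier–Stokes regularity and not a stub of the registry; class-free calculus for the residual research cell `stub_Q4sonicLineNeg`
of `Cruxes/LrcModEntire/Lines/twist_split.lean` v13 (bears_on LADDER-NS N0 via item 20428).
-/

noncomputable section

set_option linter.dupNamespace false

namespace Summit.NavierStokesRegularity.NavierStokesRegularity.Theorems.PoloidalWindowDoorLrcModEntireShearedScalarCalculus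

open Set Function Filter Topology Metric InnerProductSpace
open scoped RealInnerProductSpace InnerProductSpace ContDiff
open Literature.Analysis Literature.Analysis.FluidPDE
open Summit.NavierStokesRegularity.NavierStokesRegularity.Theorems.PoloidalWindowDoorLrcModEntireSheetFlattenTools
open Summit.NavierStokesRegularity.NavierStokesRegularity.Theorems.PoloidalWindowDoorLrcModEntireSheetSystemUniqueness
open Summit.NavierStokesRegularity.NavierStokesRegularity.Theorems.PoloidalWindowDoorLrcModEntireShearedCoordinates
open Summit.NavierStokesRegularity.NavierStokesRegularity.Theorems.PoloidalWindowDoorLrcModEntireShearedKinematics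
open Summit.NavierStokesRegularity.NavierStokesRegularity.Theorems.PoloidalWindowDoorLrcModEntireShearedSecondOrder

variable {F : ℝ × E3 → ℝ} {T : Set ℝ}

/-- Regularity of a scalar smooth on `T × ℝ³` at a point of that open set. -/
theorem scalar_regular (hT : IsOpen T) (hF : ContDiffOn ℝ ∞ F (T ×ˢ (univ : Set E3))) {q : ℝ × E3} (hq : q.1 ∈ T) :
    ContDiffAt ℝ ∞ F q ∧ DifferentiableAt ℝ F q ∧ DifferentiableAt ℝ (fderiv ℝ F) q := by
  have hg : ContDiffAt ℝ ∞ F q := hF.contDiffAt ((hT.prod isOpen_univ).mem_nhds ⟨hq, mem_univ _⟩)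
  exact ⟨hg, hg.differentiableAt (by simp), (hg.fderiv_right (m := 1) (by norm_cast)).differentiableAt (by norm_num)⟩

/-- **Time derivative:** `DF(t,x)[(1,0)] = d/ds F(s,x)|ₛ₌ₜ`. -/
theorem fderiv_scalar_time (hT : IsOpen T) (hF : ContDiffOn ℝ ∞ F (T ×ˢ (univ : Set E3))) {t : ℝ} (ht : t ∈ T) (x : E3) :
    fderiv ℝ F (t, x) ((1 : ℝ), (0 : E3)) = deriv (fun s : ℝ => F (s, x)) t := by
  obtain ⟨-, hFd, -⟩ := scalar_regular hT hF (q := (t, x)) ht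
  have hline : HasDerivAt (fun s : ℝ => ((s, x) : ℝ × E3)) ((1 : ℝ), (0 : E3)) t :=
    (hasDerivAt_id t).prodMk (hasDerivAt_const t x)
  have h := hFd.hasFDerivAt.comp_hasDerivAt t hline
  exact h.deriv.symm

/-- **Spatial second derivatives:** `D²F(t,x)[(0,a)][(0,b)] = ∂_a∂_b F(t,·)(x)`. -/
theorem fderiv_fderiv_scalar_space (hT : IsOpen T) (hF : ContDiffOn ℝ ∞ F (T ×ˢ (univ : Set E3))) {t : ℝ} (ht : t ∈ T) (x a b : E3) :
    fderiv ℝ (fderiv ℝ F) (t, x) ((0 : ℝ), a) ((0 : ℝ), b) =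
      fderiv ℝ (fun y : E3 => fderiv ℝ (fun y' : E3 => F (t, y')) y b) x a := by
  obtain ⟨-, -, hDFd⟩ := scalar_regular hT hF (q := (t, x)) ht
  have h1 : fderiv ℝ (fderiv ℝ F) (t, x) ((0 : ℝ), a) ((0 : ℝ), b) =
      fderiv ℝ (fun q' : ℝ × E3 => fderiv ℝ F q' ((0 : ℝ), b)) (t, x) ((0 : ℝ), a) := by
    rw [fderiv_clm_apply hDFd (differentiableAt_const _)]; simp
  have hd : DifferentiableAt ℝ (fun q' : ℝ × E3 => fderiv ℝ F q' ((0 : ℝ), b)) (t, x) := hDFd.clm_apply (differentiableAt_const _)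
  have h2 := fderiv_slice_eq' hd a
  -- the slice of `q' ↦ DF(q')[(0,b)]` at time `t` agrees near `x` with `y ↦ ∂_b F(t,·)(y)`
  have hfun : (fun y : E3 => fderiv ℝ F (t, y) ((0 : ℝ), b)) = fun y => fderiv ℝ (fun y' : E3 => F (t, y')) y b := by
    funext y
    obtain ⟨-, hFy, -⟩ := scalar_regular hT hF (q := (t, y)) ht
    exact (fderiv_slice_eq' hFy b).symm
  rw [h1, ← h2, hfun]

variable {e : E3} {O : Set Y3} {D : Set (ℝ × ℝ)} {d : ℝ × ℝ → ℝ}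

/-- ★ **The horizontal Laplacian in sheared coordinates, for a general scalar:** `∂_m²(F∘Φ)(p) + ∂_s²(F∘Φ)(p) = ∂₀∂₀F(t,·)(x) + ∂₁∂₁F(t,·)(x)`
(`t = p.1.1`, `x = shearPt e d p`, `e` a horizontal unit vector). -/
theorem pd_sum_scalar_comp_shearMap (hO : IsOpen O) (hT : IsOpen T) (hF : ContDiffOn ℝ ∞ F (T ×ˢ (univ : Set E3)))
    (he2 : e 2 = 0) (hunit : e 0 ^ 2 + e 1 ^ 2 = 1)
    (hOT : ∀ y ∈ O, y.1 ∈ T) (hD : IsOpen D) (hd : ContDiffOn ℝ ∞ d D) (hOD : ∀ y ∈ O, (y.1, y.2.2) ∈ D) {p : Y3 × ℝ} (hp : p ∈ tube O) :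
    pd dN (pd dN (F ∘ shearMap e d)) p + pd (tg eS) (pd (tg eS) (F ∘ shearMap e d)) p =
      fderiv ℝ (fun y : E3 => fderiv ℝ (fun y' : E3 => F (p.1.1, y')) y (EuclideanSpace.single 0 (1 : ℝ))) (shearPt e d p) (EuclideanSpace.single 0 (1 : ℝ)) +
        fderiv ℝ (fun y : E3 => fderiv ℝ (fun y' : E3 => F (p.1.1, y')) y (EuclideanSpace.single 1 (1 : ℝ))) (shearPt e d p) (EuclideanSpace.single 1 (1 : ℝ)) := by
  rw [pd_dN_pd_dN_comp_shearMap hO hT hF hOT hD hd hOD hp, pd_tgS_pd_tgS_comp_shearMap hO hT hF hOT hD hd hOD hp]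
  have ht : p.1.1 ∈ T := hOT p.1 hp
  have hq : shearMap e d p = (p.1.1, shearPt e d p) := rfl
  rw [hq]
  set B : E3 →L[ℝ] E3 →L[ℝ] ℝ :=
    (fderiv ℝ (fderiv ℝ F) (p.1.1, shearPt e d p)).bilinearComp (ContinuousLinearMap.inr ℝ ℝ E3) (ContinuousLinearMap.inr ℝ ℝ E3) with hB
  have hBab : ∀ a b : E3, B a b = fderiv ℝ (fderiv ℝ F) (p.1.1, shearPt e d p) ((0 : ℝ), a) ((0 : ℝ), b) := fun a b => by
    simp [hB]
  have hfr := bilin_frame_trace B he2 hunit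
  rw [hBab, hBab, hBab, hBab] at hfr
  rw [add_comm, hfr, fderiv_fderiv_scalar_space hT hF ht, fderiv_fderiv_scalar_space hT hF ht]

end Summit.NavierStokesRegularity.NavierStokesRegularity.Theorems.PoloidalWindowDoorLrcModEntireShearedScalarCalculus

end
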